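import Literature.Probability.LatticeModels.RandomClusterRimWiringWired
import HarnessLib

/-!
# Markov property at an explored set, ambient wiring OUTSIDE: the cluster-count identity and the sums

Topic `Literature/Probability/LatticeModels` (trunk `StatMech`, family `crit-ising`). Combinatorial
core of `RandomClusterRimWiringOutside.lean` (exploration FROM INSIDE, Basu–Sapozhnikov 2017 §2;
Kesten 1986, proof of Thm. 3; Grimmett 2006, Lemma (4.13)): `S` is the explored vertex set, `T` the
set of edges of `G` TOUCHING `S`, `R ⊆ Sᶜ` the rim, and the ambient wired set `B` of `φ^B_{G,p,q}`
lies in the UNEXPLORED side (`B ∩ S = ∅`). For `ζ ⊆ T` whose endpoints outside `S` lie in `R` and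
which joins any two rim vertices (the configurations of the context event `F`), and `η ⊆ E(G) ∖ T`:

* `clusterCount_union_add_eq_of_rim_wired_outside` — `k^B(ζ ∪ η) + k^R(∅) = k^∅(ζ) + k^R(η ∪ E(K_B))`
  (`clusterCount_union_add_eq` of `RandomClusterRimWiring.lean` with inside and outside exchanged:
  the unexplored side is the region, `ζ` wires its rim `R`, the wiring `K_B` is a bunch of region
  edges); hence the weights factorise, `rcWeight_union_mul_eq_of_rim_wired_outside`, and
  `Z φ(F ∩ A ∩ C) q^{k^R(∅)}` is a product of a `T`-sum and an `(E ∖ T)`-sum,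
  `rcPartitionFunction_mul_real_inter_mul_pow_eq_of_rim_wired_outside`;
* `clusterCount_union_wired_edgeSet_le` — the two-block count `k^R(η ∪ E(K_B))` and the one-block
  count `k^{R ∪ B}(η)` differ by `0` or `1`, so the `(E ∖ T)`-sums are within `q^{±1}` of the
  one-block weights of `⟨E ∖ T⟩` (`sum_rcWeight_fromEdgeSet_le_two_blocks`, `q ≥ 1`).

Everything is proved; no definitions, no named facts.

## References

* G. Grimmett, *The Random-Cluster Model*, Springer (2006): §4.2, eqs. (4.11)–(4.13), Lemma (4.13).
* D. Basu, A. Sapozhnikov, Kesten's incipient infinite cluster and quasi-multiplicativity of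
  crossing probabilities, *Electron. Commun. Probab.* 22 (2017), §2.
* H. Kesten, The incipient infinite cluster in two-dimensional percolation, *Probab. Theory Related
  Fields* 73 (1986) 369–394: proof of Thm. 3.
-/

noncomputable section

open MeasureTheory Finset SimpleGraph
open Literature.Probability.Percolation (BondConfig)

namespace Literature.Probability.LatticeModels

/-! ### Two wired blocks versus one -/

section TwoBlocks

variable {V : Type*} [Finite V]

/-- **Two wired blocks versus one.** Wiring `R` and `B` separately (the block `B` realised by the
edges of the complete graph `K_B`) gives at least as many clusters as wiring `R ∪ B`, and at most one
more: `k^{R ∪ B}(η) ≤ k^R(η ∪ E(K_B)) ≤ k^{R ∪ B}(η) + 1` (one extra edge between `R` and `B` merges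
the two blocks). [cite: Grimmett2006, §4.2, Lemma (4.13)] -/
theorem clusterCount_union_wired_edgeSet_le (η : Set (Sym2 V)) (R B : Set V) :
    clusterCount η (R ∪ B) ≤ clusterCount (η ∪ (wired B).edgeSet) R ∧
      clusterCount (η ∪ (wired B).edgeSet) R ≤ clusterCount η (R ∪ B) + 1 := by
  unfold clusterCount Percolation.openGraph
  rw [fromEdgeSet_union, fromEdgeSet_edgeSet]
  have hle : fromEdgeSet η ⊔ wired B ⊔ wired R ≤ fromEdgeSet η ⊔ wired (R ∪ B) :=
    sup_le (sup_le le_sup_left ((wired_mono Set.subset_union_right).trans le_sup_right))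
      ((wired_mono Set.subset_union_left).trans le_sup_right)
  refine ⟨ConnectedComponent.card_le_card_of_le hle, ?_⟩
  by_cases hne : R.Nonempty ∧ B.Nonempty
  · obtain ⟨⟨r, hr⟩, ⟨b, hb⟩⟩ := hne
    -- every vertex of `R ∪ B` is joined to `r` once the edge `rb` is added
    have hjoin : ∀ x ∈ R ∪ B, (fromEdgeSet η ⊔ wired B ⊔ wired R ⊔ edge r b).Reachable x r := by
      intro x hx
      rcases hx with hx | hx
      · by_cases hxr : x = r
        · subst hxr; exact Reachable.refl _
        · have h : (fromEdgeSet η ⊔ wired B ⊔ wired R ⊔ edge r b).Adj x r :=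
            Or.inl (Or.inr (by rw [wired_adj]; exact ⟨hxr, hx, hr⟩))
          exact h.reachable
      · have hxb : (fromEdgeSet η ⊔ wired B ⊔ wired R ⊔ edge r b).Reachable x b := by
          by_cases hxb : x = b
          · subst hxb; exact Reachable.refl _
          · have h : (fromEdgeSet η ⊔ wired B ⊔ wired R ⊔ edge r b).Adj x b :=
              Or.inl (Or.inl (Or.inr (by rw [wired_adj]; exact ⟨hxb, hx, hb⟩)))
            exact h.reachable
        have hbr : (fromEdgeSet η ⊔ wired B ⊔ wired R ⊔ edge r b).Reachable b r := by
          by_cases hbr : b = r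
          · subst hbr; exact Reachable.refl _
          · have h : (fromEdgeSet η ⊔ wired B ⊔ wired R ⊔ edge r b).Adj b r :=
              Or.inr (by rw [edge_adj]; exact ⟨Or.inr ⟨rfl, rfl⟩, hbr⟩)
            exact h.reachable
        exact hxb.trans hbr
    have h1 : Nat.card (fromEdgeSet η ⊔ wired B ⊔ wired R ⊔ edge r b).ConnectedComponent =
        Nat.card (fromEdgeSet η ⊔ wired (R ∪ B) ⊔ edge r b).ConnectedComponent := by
      refine card_connectedComponent_eq_of_le_of_adj_imp_reachable (sup_le_sup_right hle _)
        fun v w hvw ↦ ?_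
      rcases hvw with (hvw | hvw) | hvw
      · have h : (fromEdgeSet η ⊔ wired B ⊔ wired R ⊔ edge r b).Adj v w := Or.inl (Or.inl (Or.inl hvw))
        exact h.reachable
      · rw [wired_adj] at hvw
        obtain ⟨-, hv, hw⟩ := hvw
        exact (hjoin v hv).trans (hjoin w hw).symm
      · have h : (fromEdgeSet η ⊔ wired B ⊔ wired R ⊔ edge r b).Adj v w := Or.inr hvw
        exact h.reachable
    have h2 : Nat.card (fromEdgeSet η ⊔ wired (R ∪ B) ⊔ edge r b).ConnectedComponent =
        Nat.card (fromEdgeSet η ⊔ wired (R ∪ B)).ConnectedComponent := by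
      refine card_connectedComponent_sup_edge_of_reachable _ ?_
      by_cases hrb : r = b
      · subst hrb; exact Reachable.refl _
      · have h : (fromEdgeSet η ⊔ wired (R ∪ B)).Adj r b :=
          Or.inr (by rw [wired_adj]; exact ⟨hrb, Or.inl hr, Or.inr hb⟩)
        exact h.reachable
    have h3 := card_connectedComponent_le_sup_edge_add_one (fromEdgeSet η ⊔ wired B ⊔ wired R) r b
    omega
  · -- one of the two blocks is empty
    have hle' : fromEdgeSet η ⊔ wired (R ∪ B) ≤ fromEdgeSet η ⊔ wired B ⊔ wired R := by
      refine sup_le (le_sup_left.trans le_sup_left) ?_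
      rcases not_and_or.1 hne with h | h
      · rw [Set.not_nonempty_iff_eq_empty] at h
        rw [h, Set.empty_union]
        exact le_sup_right.trans le_sup_left
      · rw [Set.not_nonempty_iff_eq_empty] at h
        rw [h, Set.union_empty]
        exact le_sup_right
    have h4 := ConnectedComponent.card_le_card_of_le hle'
    omega

end TwoBlocks

/-! ### The cluster-count identity -/

section ClusterCount

variable {V : Type*} [Fintype V] [DecidableEq V]

/-- **Cluster counts at an explored set with the ambient wiring outside.** Let `ζ` be a set of
edges whose endpoints outside `S` lie in the rim `R` and which joins any two rim vertices, `η` a set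
of edges with no endpoint in `S`, and `B ∩ S = ∅`. Then
`k^B(ζ ∪ η) + k^R(∅) = k^∅(ζ) + k^R(η ∪ E(K_B))`: the `ζ`-part is free of `B` (and of the graph),
the `η`-part is the two-block count. (`clusterCount_union_add_eq` with the roles of inside and
outside exchanged: the unexplored side `Sᶜ` is the region, `ζ` wires its rim `R`, and the ambient
wiring `K_B` is a bunch of region edges.) [cite: Grimmett2006, §4.2, Lemma (4.13)] -/
theorem clusterCount_union_add_eq_of_rim_wired_outside {S R B : Set V} {ζ η : Finset (Sym2 V)}
    (hζS : ∀ e ∈ ζ, ∀ x ∈ e, x ∉ S → x ∈ R)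
    (hζR : ∀ x ∈ R, ∀ y ∈ R, (fromEdgeSet (ζ : Set (Sym2 V))).Reachable x y)
    (hηS : ∀ e ∈ η, ∀ x ∈ e, x ∉ S) (hBS : ∀ b ∈ B, b ∉ S) :
    clusterCount (↑(ζ ∪ η) : BondConfig V) B + clusterCount (∅ : BondConfig V) R =
      clusterCount (↑ζ : BondConfig V) ∅ +
        clusterCount ((↑η : Set (Sym2 V)) ∪ (wired B).edgeSet) R := by
  classical
  obtain ⟨EB, hEB⟩ : ∃ EB : Finset (Sym2 V), (↑EB : Set (Sym2 V)) = (wired B).edgeSet :=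
    ⟨(wired B).edgeSet.toFinite.toFinset, Set.Finite.coe_toFinset _⟩
  have haX : ∀ e ∈ η ∪ EB, ∀ x ∈ e, x ∈ Sᶜ := by
    intro e he x hx
    rcases Finset.mem_union.1 he with he | he
    · exact hηS e he x hx
    · have he' : e ∈ (wired B).edgeSet := by rw [← hEB]; exact Finset.mem_coe.2 he
      induction e using Sym2.ind with
      | h a b =>
        rw [mem_edgeSet, wired_adj] at he'
        rcases Sym2.mem_iff.1 hx with rfl | rfl
        · exact hBS _ he'.2.1
        · exact hBS _ he'.2.2
  have key := clusterCount_union_add_eq (η ∪ EB) (↑ζ : Set (Sym2 V)) (W := R) (X := Sᶜ) haX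
    (fun e he x hx hxS ↦ hζS e (Finset.mem_coe.1 he) x hx hxS) hζR
  have h1 : clusterCount ((↑(η ∪ EB) : Set (Sym2 V)) ∪ ↑ζ) ∅ =
      clusterCount (↑(ζ ∪ η) : BondConfig V) B := by
    unfold clusterCount Percolation.openGraph
    rw [Finset.coe_union, Finset.coe_union, hEB, fromEdgeSet_union, fromEdgeSet_union,
      fromEdgeSet_union, fromEdgeSet_edgeSet, wired_empty, sup_bot_eq]
    have h : fromEdgeSet (↑η : Set (Sym2 V)) ⊔ wired B ⊔ fromEdgeSet (↑ζ : Set (Sym2 V)) =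
        fromEdgeSet (↑ζ : Set (Sym2 V)) ⊔ fromEdgeSet (↑η : Set (Sym2 V)) ⊔ wired B := by ac_rfl
    rw [h]
  have h2 : clusterCount (↑(η ∪ EB) : BondConfig V) R =
      clusterCount ((↑η : Set (Sym2 V)) ∪ (wired B).edgeSet) R := by
    rw [Finset.coe_union, hEB]
  rw [← h1, ← h2]
  exact key

end ClusterCount

/-! ### Weights and sums -/

section Finite

variable {V : Type*} [Fintype V] [DecidableEq V] (G : SimpleGraph V) [DecidableRel G.Adj]

omit [Fintype V] in
/-- For `η` disjoint from `T`, the part of `ζ ∪ η` on `T` is that of `ζ`. [folklore] -/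
theorem coe_union_inter_coe_eq_of_disjoint_right {ζ η T : Finset (Sym2 V)} (hηT : Disjoint η T) :
    (↑(ζ ∪ η) : Set (Sym2 V)) ∩ ↑T = ↑ζ ∩ ↑T := by
  rw [Finset.coe_union, Set.union_inter_distrib_right, ← Finset.coe_inter η T,
    Finset.disjoint_iff_inter_eq_empty.1 hηT, Finset.coe_empty, Set.union_empty]

omit [Fintype V] in
/-- For `ζ` disjoint from `M`, the part of `ζ ∪ η` on `M` is that of `η`. [folklore] -/
theorem coe_union_inter_coe_eq_of_disjoint_left {ζ η M : Finset (Sym2 V)} (hζM : Disjoint ζ M) :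
    (↑(ζ ∪ η) : Set (Sym2 V)) ∩ ↑M = ↑η ∩ ↑M := by
  rw [Finset.coe_union, Set.union_inter_distrib_right, ← Finset.coe_inter ζ M,
    Finset.disjoint_iff_inter_eq_empty.1 hζM, Finset.coe_empty, Set.empty_union]

/-- **Weights factorise at an explored set with the ambient wiring outside.** For `T ⊆ E(G)`,
`ζ ⊆ T` whose endpoints outside `S` lie in `R` and which wires `R`, `η ⊆ E(G) ∖ T` without endpoints
in `S`, and `B ∩ S = ∅`:
`w^B_G(ζ ∪ η) · q^{k^R(∅)} = [p^{|ζ|} (1-p)^{|T ∖ ζ|} q^{k^∅(ζ)}] · [p^{|η|} (1-p)^{|E ∖ T ∖ η|} q^{k^R(η ∪ E(K_B))}]`.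
[cite: Grimmett2006, §4.2 eq. (4.12) and Lemma (4.13)] -/
theorem rcWeight_union_mul_eq_of_rim_wired_outside (p q : ℝ) {S R B : Set V}
    {T ζ η : Finset (Sym2 V)} (hT : T ⊆ G.edgeFinset) (hζ : ζ ⊆ T) (hη : η ⊆ G.edgeFinset \ T)
    (hζS : ∀ e ∈ ζ, ∀ x ∈ e, x ∉ S → x ∈ R)
    (hζR : ∀ x ∈ R, ∀ y ∈ R, (fromEdgeSet (ζ : Set (Sym2 V))).Reachable x y)
    (hηS : ∀ e ∈ η, ∀ x ∈ e, x ∉ S) (hBS : ∀ b ∈ B, b ∉ S) :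
    rcWeight G p q B (ζ ∪ η) * q ^ clusterCount (∅ : BondConfig V) R =
      (p ^ #ζ * (1 - p) ^ #(T \ ζ) * q ^ clusterCount (↑ζ : BondConfig V) ∅) *
        (p ^ #η * (1 - p) ^ #((G.edgeFinset \ T) \ η) *
          q ^ clusterCount ((↑η : Set (Sym2 V)) ∪ (wired B).edgeSet) R) := by
  have hηT : Disjoint η T := Finset.disjoint_of_subset_left hη sdiff_disjoint
  have hζη : Disjoint ζ η := (Finset.disjoint_of_subset_right hζ hηT).symm
  have hcard₁ : #(ζ ∪ η) = #ζ + #η := card_union_of_disjoint hζη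
  have hsplit : G.edgeFinset \ (ζ ∪ η) = (T \ ζ) ∪ ((G.edgeFinset \ T) \ η) := by
    ext e
    simp only [mem_sdiff, mem_union, not_or]
    constructor
    · rintro ⟨heE, heζ, heη⟩
      by_cases heT : e ∈ T
      · exact Or.inl ⟨heT, heζ⟩
      · exact Or.inr ⟨⟨heE, heT⟩, heη⟩
    · rintro (⟨heT, heζ⟩ | ⟨⟨heE, heT⟩, heη⟩)
      · exact ⟨hT heT, heζ, fun h ↦ (Finset.disjoint_left.1 hηT h) heT⟩
      · exact ⟨heE, fun h ↦ heT (hζ h), heη⟩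
  have hdisj : Disjoint (T \ ζ) ((G.edgeFinset \ T) \ η) :=
    Finset.disjoint_of_subset_left sdiff_subset
      (Finset.disjoint_of_subset_right sdiff_subset disjoint_sdiff)
  have hcard₂ : #(G.edgeFinset \ (ζ ∪ η)) = #(T \ ζ) + #((G.edgeFinset \ T) \ η) := by
    rw [hsplit, card_union_of_disjoint hdisj]
  have hk := clusterCount_union_add_eq_of_rim_wired_outside (ζ := ζ) (η := η) hζS hζR hηS hBS
  have hqk : q ^ clusterCount (↑(ζ ∪ η) : BondConfig V) B * q ^ clusterCount (∅ : BondConfig V) R =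
      q ^ clusterCount (↑ζ : BondConfig V) ∅ *
        q ^ clusterCount ((↑η : Set (Sym2 V)) ∪ (wired B).edgeSet) R := by
    rw [← pow_add, ← pow_add, hk]
  unfold rcWeight
  rw [hcard₁, hcard₂, pow_add, pow_add]
  linear_combination (p ^ #ζ * p ^ #η * ((1 - p) ^ #(T \ ζ) * (1 - p) ^ #((G.edgeFinset \ T) \ η))) * hqk

/-- **Splitting the measure of an event along `T` and `E ∖ T`.** For `T ⊆ E(G)`, an event `F`
determined by the configuration on `T` and an event `C` determined by the configuration on
`E(G) ∖ T`, `Z · φ(F ∩ C) = ∑_{ζ ⊆ T} ∑_{η ⊆ E ∖ T} w(ζ ∪ η) 1_F(ζ) 1_C(η)`.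
[cite: Grimmett2006, §4.2, eq. (4.12)] -/
theorem rcPartitionFunction_mul_real_inter_eq_sum_sum {p q : ℝ} (hp : p ∈ Set.Icc (0 : ℝ) 1)
    (hq : 0 < q) (B : Set V) {T : Finset (Sym2 V)} (hT : T ⊆ G.edgeFinset) (F C : Set (BondConfig V))
    (hF : ∀ ω₁ ω₂ : BondConfig V, ω₁ ∩ ↑T = ω₂ ∩ ↑T → (ω₁ ∈ F ↔ ω₂ ∈ F))
    (hC : ∀ ω₁ ω₂ : BondConfig V,
      ω₁ ∩ ↑(G.edgeFinset \ T) = ω₂ ∩ ↑(G.edgeFinset \ T) → (ω₁ ∈ C ↔ ω₂ ∈ C))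
    [DecidablePred (· ∈ F)] [DecidablePred (· ∈ C)] :
    rcPartitionFunction G p q B * (rcMeasure G p q B).real (F ∩ C) =
      ∑ ζ ∈ T.powerset, ∑ η ∈ (G.edgeFinset \ T).powerset,
        rcWeight G p q B (ζ ∪ η) * (if (↑ζ : BondConfig V) ∈ F then 1 else 0) *
          (if (↑η : BondConfig V) ∈ C then 1 else 0) := by
  classical
  have hZ := rcPartitionFunction_pos G hp hq B
  rw [rcMeasure_real_apply G hp hq B (F ∩ C), Finset.mul_sum, sum_powerset_edgeFinset_split G T hT]
  refine Finset.sum_congr rfl fun ζ hζ ↦ Finset.sum_congr rfl fun η hη ↦ ?_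
  rw [Finset.mem_powerset] at hζ hη
  have hηT : Disjoint η T := Finset.disjoint_of_subset_left hη sdiff_disjoint
  have hζM : Disjoint ζ (G.edgeFinset \ T) := Finset.disjoint_of_subset_left hζ disjoint_sdiff
  have hFiff : ((↑(ζ ∪ η) : BondConfig V) ∈ F) ↔ ((↑ζ : BondConfig V) ∈ F) :=
    hF _ _ (coe_union_inter_coe_eq_of_disjoint_right hηT)
  have hCiff : ((↑(ζ ∪ η) : BondConfig V) ∈ C) ↔ ((↑η : BondConfig V) ∈ C) :=
    hC _ _ (coe_union_inter_coe_eq_of_disjoint_left hζM)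
  by_cases hFζ : (↑ζ : BondConfig V) ∈ F
  · by_cases hCη : (↑η : BondConfig V) ∈ C
    · rw [if_pos ⟨hFiff.2 hFζ, hCiff.2 hCη⟩, if_pos hFζ, if_pos hCη]
      field_simp
    · rw [if_neg (fun h ↦ hCη (hCiff.1 h.2)), if_pos hFζ, if_neg hCη]
      simp
  · rw [if_neg (fun h ↦ hFζ (hFiff.1 h.1)), if_neg hFζ]
    simp

/-- **Factorised form of `Z · φ(F ∩ A ∩ C)` at an explored set with the ambient wiring outside.**
With `T` the edges touching `S`, `F` a context event determined on `T` satisfying (rim) and (wire),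
`B ∩ S = ∅`, `A` determined on `T` and `C` determined on `E ∖ T`:
`Z · φ^B_G(F ∩ A ∩ C) · q^{k^R(∅)} = [∑_{ζ ⊆ T, ζ ∈ F ∩ A} p^{|ζ|} (1-p)^{|T∖ζ|} q^{k^∅(ζ)}] ·
[∑_{η ⊆ E∖T, η ∈ C} p^{|η|} (1-p)^{|E∖T∖η|} q^{k^R(η ∪ E(K_B))}]`.
[cite: Grimmett2006, §4.2, eq. (4.12) and Lemma (4.13)] -/
theorem rcPartitionFunction_mul_real_inter_mul_pow_eq_of_rim_wired_outside {p q : ℝ}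
    (hp : p ∈ Set.Icc (0 : ℝ) 1) (hq : 0 < q) {B S R : Set V} {T : Finset (Sym2 V)}
    (hT : ∀ e, e ∈ T ↔ e ∈ G.edgeFinset ∧ ∃ v ∈ S, v ∈ e) (hBS : ∀ b ∈ B, b ∉ S)
    {F : Set (BondConfig V)}
    (hFdet : ∀ ω₁ ω₂ : BondConfig V, ω₁ ∩ ↑T = ω₂ ∩ ↑T → (ω₁ ∈ F ↔ ω₂ ∈ F))
    (hFrim : ∀ ω ∈ F, ∀ e ∈ ω, e ∈ T → ∀ x ∈ e, x ∉ S → x ∈ R)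
    (hFwire : ∀ ω ∈ F, ∀ x ∈ R, ∀ y ∈ R, (fromEdgeSet (ω ∩ ↑T)).Reachable x y)
    (A C : Set (BondConfig V))
    (hA : ∀ ω₁ ω₂ : BondConfig V, ω₁ ∩ ↑T = ω₂ ∩ ↑T → (ω₁ ∈ A ↔ ω₂ ∈ A))
    (hC : ∀ ω₁ ω₂ : BondConfig V,
      ω₁ ∩ ↑(G.edgeFinset \ T) = ω₂ ∩ ↑(G.edgeFinset \ T) → (ω₁ ∈ C ↔ ω₂ ∈ C))
    [DecidablePred (· ∈ F ∩ A)] [DecidablePred (· ∈ C)] :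
    rcPartitionFunction G p q B * (rcMeasure G p q B).real (F ∩ A ∩ C) *
        q ^ clusterCount (∅ : BondConfig V) R =
      (∑ ζ ∈ T.powerset, if (↑ζ : BondConfig V) ∈ F ∩ A then
          p ^ #ζ * (1 - p) ^ #(T \ ζ) * q ^ clusterCount (↑ζ : BondConfig V) ∅ else 0) *
        ∑ η ∈ (G.edgeFinset \ T).powerset, if (↑η : BondConfig V) ∈ C then
          p ^ #η * (1 - p) ^ #((G.edgeFinset \ T) \ η) *
            q ^ clusterCount ((↑η : Set (Sym2 V)) ∪ (wired B).edgeSet) R else 0 := by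
  have hTE : T ⊆ G.edgeFinset := fun e he ↦ ((hT e).1 he).1
  have hFA : ∀ ω₁ ω₂ : BondConfig V, ω₁ ∩ ↑T = ω₂ ∩ ↑T → (ω₁ ∈ F ∩ A ↔ ω₂ ∈ F ∩ A) :=
    fun ω₁ ω₂ h ↦ by
      rw [Set.mem_inter_iff, Set.mem_inter_iff]
      exact and_congr (hFdet ω₁ ω₂ h) (hA ω₁ ω₂ h)
  rw [rcPartitionFunction_mul_real_inter_eq_sum_sum G hp hq B hTE (F ∩ A) C hFA hC, Finset.sum_mul,
    Finset.sum_mul_sum]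
  refine Finset.sum_congr rfl fun ζ hζ ↦ ?_
  rw [Finset.sum_mul]
  refine Finset.sum_congr rfl fun η hη ↦ ?_
  rw [Finset.mem_powerset] at hζ hη
  by_cases hζFA : (↑ζ : BondConfig V) ∈ F ∩ A
  · have hζF : (↑ζ : BondConfig V) ∈ F := hζFA.1
    have hζS : ∀ e ∈ ζ, ∀ x ∈ e, x ∉ S → x ∈ R := fun e he x hx hxS ↦
      hFrim _ hζF e (Finset.mem_coe.2 he) (hζ he) x hx hxS
    have hζR : ∀ x ∈ R, ∀ y ∈ R, (fromEdgeSet (ζ : Set (Sym2 V))).Reachable x y := by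
      intro x hx y hy
      have h := hFwire _ hζF x hx y hy
      rwa [Set.inter_eq_left.2 (Finset.coe_subset.2 hζ)] at h
    have hηS : ∀ e ∈ η, ∀ x ∈ e, x ∉ S := by
      intro e he x hx hxS
      have he' := Finset.mem_sdiff.1 (hη he)
      exact he'.2 ((hT e).2 ⟨he'.1, x, hxS, hx⟩)
    have hw := rcWeight_union_mul_eq_of_rim_wired_outside G p q hTE hζ hη hζS hζR hηS hBS
    rw [if_pos hζFA, if_pos hζFA]
    by_cases hηC : (↑η : BondConfig V) ∈ C
    · rw [if_pos hηC, if_pos hηC, mul_one, mul_one, hw]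
    · rw [if_neg hηC, if_neg hηC, mul_zero, zero_mul, mul_zero]
  · rw [if_neg hζFA, if_neg hζFA]
    simp

/-- **The two-block sums are within `q^{±1}` of the one-block weights.** For `M ⊆ E(G)`, `q ≥ 1`
and any event `C`: `∑_{η ⊆ M, η ∈ C} w^{R ∪ B}_{⟨M⟩}(η) ≤ ∑_{η ⊆ M, η ∈ C} p^{|η|} (1-p)^{|M∖η|}
q^{k^R(η ∪ E(K_B))} ≤ q · ∑_{η ⊆ M, η ∈ C} w^{R ∪ B}_{⟨M⟩}(η)`. [cite: Grimmett2006, §4.2, Lemma (4.13)] -/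
theorem sum_rcWeight_fromEdgeSet_le_two_blocks {p q : ℝ} (hp : p ∈ Set.Icc (0 : ℝ) 1) (hq : 1 ≤ q)
    (R B : Set V) {M : Finset (Sym2 V)} (hM : M ⊆ G.edgeFinset) (C : Set (BondConfig V))
    [DecidablePred (· ∈ C)] :
    (∑ η ∈ M.powerset, if (↑η : BondConfig V) ∈ C then
        rcWeight (fromEdgeSet (M : Set (Sym2 V))) p q (R ∪ B) η else 0) ≤
      (∑ η ∈ M.powerset, if (↑η : BondConfig V) ∈ C then
        p ^ #η * (1 - p) ^ #(M \ η) * q ^ clusterCount ((↑η : Set (Sym2 V)) ∪ (wired B).edgeSet) R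
        else 0) ∧
    (∑ η ∈ M.powerset, if (↑η : BondConfig V) ∈ C then
        p ^ #η * (1 - p) ^ #(M \ η) * q ^ clusterCount ((↑η : Set (Sym2 V)) ∪ (wired B).edgeSet) R
        else 0) ≤
      q * ∑ η ∈ M.powerset, if (↑η : BondConfig V) ∈ C then
        rcWeight (fromEdgeSet (M : Set (Sym2 V))) p q (R ∪ B) η else 0 := by
  have hEU : ∀ i : Fintype (fromEdgeSet (M : Set (Sym2 V))).edgeSet,
      @SimpleGraph.edgeFinset V (fromEdgeSet (M : Set (Sym2 V))) i = M := fun i ↦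
    @edgeFinset_fromEdgeSet_of_subset V _ G _ M hM i
  have h0p : 0 ≤ p := hp.1
  have h1p : 0 ≤ 1 - p := sub_nonneg.2 hp.2
  have hterm : ∀ η : Finset (Sym2 V),
      (rcWeight (fromEdgeSet (M : Set (Sym2 V))) p q (R ∪ B) η ≤
        p ^ #η * (1 - p) ^ #(M \ η) * q ^ clusterCount ((↑η : Set (Sym2 V)) ∪ (wired B).edgeSet) R) ∧
      (p ^ #η * (1 - p) ^ #(M \ η) * q ^ clusterCount ((↑η : Set (Sym2 V)) ∪ (wired B).edgeSet) R ≤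
        q * rcWeight (fromEdgeSet (M : Set (Sym2 V))) p q (R ∪ B) η) := by
    intro η
    obtain ⟨h1, h2⟩ := clusterCount_union_wired_edgeSet_le (↑η : Set (Sym2 V)) R B
    simp only [rcWeight, hEU]
    have hpp : 0 ≤ p ^ #η * (1 - p) ^ #(M \ η) := by positivity
    constructor
    · exact mul_le_mul_of_nonneg_left (pow_le_pow_right₀ hq h1) hpp
    · calc p ^ #η * (1 - p) ^ #(M \ η) * q ^ clusterCount ((↑η : Set (Sym2 V)) ∪ (wired B).edgeSet) R
          ≤ p ^ #η * (1 - p) ^ #(M \ η) * q ^ (clusterCount (↑η : BondConfig V) (R ∪ B) + 1) :=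
            mul_le_mul_of_nonneg_left (pow_le_pow_right₀ hq h2) hpp
        _ = q * (p ^ #η * (1 - p) ^ #(M \ η) * q ^ clusterCount (↑η : BondConfig V) (R ∪ B)) := by
            rw [pow_succ]; ring
  constructor
  · refine Finset.sum_le_sum fun η _ ↦ ?_
    split_ifs
    · exact (hterm η).1
    · exact le_rfl
  · rw [Finset.mul_sum]
    refine Finset.sum_le_sum fun η _ ↦ ?_
    split_ifs
    · exact (hterm η).2
    · simp

end Finite

end Literature.Probability.LatticeModels

end
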